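import Mathlib
import HarnessLib

/-!
# Lovas–Andai's defect function `χ₁` of the operator-norm unit ball of `ℝ^{2×2}`
# (Lovas–Andai 2017, Definition 1, Lemma 6, and `χ₁(1) = 2π²/3`)

Topic `Literature/Probability/RandomMatrix`; NAMED FACTS (D-0014, statements only) requested by route
`Summit.KontsevichZagierPeriods.KontsevichZagierPeriods.Theses.SeparabilityScissors` (value side of
item `DefectLogRebit`, stmt-KontsevichZagierPeriods-8494, the first brick of `RebitCore2964`).
Companion of `TwoQubitSeparabilityVolumes.lean` (the `29/64` and `8/33` facts).

## What is printed (A. Lovas, A. Andai, J. Phys. A 50 (2017) 295303 [LovasAndai2017]; held text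
arXiv:1610.01410, §2 and §5 read)

* Lemma 3: for `X ∈ 𝕂^{n×n}`, "`X*X < I ⟺ ‖X‖ < 1`, where `‖·‖` denotes the usual operator norm".
* "The standard unit ball in the normed vector space of `2 × 2` matrices is denoted by `𝓑_𝕂`."
  **Definition 1.** `χ_d(ε) = ∫_{𝓑_𝕂} 𝟙_{‖V_ε⁻¹ X V_ε‖ < 1} dλ_{4d}(X)`, `V_ε = diag(1, ε)`,
  `d = dim_ℝ 𝕂`; "The normalized `χ_d`-function `χ̃_d(ε) = χ_d(ε)/χ_d(1)` measures the probability
  that a uniformly distributed matrix in `𝓑_𝕂` is mapped in `𝓑_𝕂` by the similarity transformation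
  `V_ε⁻¹ (·) V_ε`."
* **Lemma 6.** "The function `χ̃₁(ε) : [0,1] → [0,1]` can be expressed as follows
  `χ̃₁(ε) = 1 − (4/π²) ∫_ε^1 (s + 1/s − ½ (s − 1/s)² log((1+s)/(1−s))) (1/s) ds
        = (4/π²) ∫₀^ε (s + 1/s − ½ (s − 1/s)² log((1+s)/(1−s))) (1/s) ds`."
  (Proof in their Appendix A.)
* §5 (Examples), real case: "`χ₁(1) = (2/3) π²`".

## Rendering

* `X = [[z0, z1], [z2, z3]]` with entry coordinates `z ∈ ℝ⁴`; `λ₄` = `volume` on `Fin 4 → ℝ`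
  (for `d = 1` Lovas–Andai's `λ₄` is this Lebesgue measure: `χ₁(1) = 2π²/3` is also the elementary
  value of `volume {‖X‖ ≤ 1}` — via `X = uI + vJ + wK + xL`, Jacobian `4`, singular values
  `√(u²+v²) ± √(w²+x²)`, `4 · (2π)² ∫₀¹ r₁ (1−r₁)²/2 dr₁ = 2π²/3` — and it is the value the route's
  kit Monte-Carlo j000373 reproduces, `6.576`).
* `‖X‖ < 1` is spelled through Lemma 3 as `(1 − XᵀX).PosDef` (no choice among Mathlib's matrix
  norms is then needed); `V_ε⁻¹ X V_ε = [[z0, ε z1], [z2/ε, z3]]` is written out (`lovasAndaiConj`),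
  valid for `ε ≠ 0`, and Lemma 6 is stated for `0 < ε ≤ 1` (at `ε = 0` both printed sides are `0`
  by continuity/convention; not asserted).
* The integrand of Lemma 6 is continuous on `(0,1)` with limit `8/3` at `0⁺` and integrable
  logarithmic behaviour at `1⁻`; the integral is the Lebesgue integral over `Set.Ioc 0 ε`.

## References

* [LovasAndai2017] Lovas–Andai 2017, §2 Lemma 3, Definition 1, Lemma 6 (proof: App. A), §5
  (`χ₁(1) = 2π²/3`). arXiv:1610.01410.
-/

noncomputable section

open MeasureTheory
open scoped ENNReal Matrix

namespace Literature.Probability.RandomMatrix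

/-- The real `2 × 2` matrix with entry coordinates `z ∈ ℝ⁴`, `X = [[z0, z1], [z2, z3]]`. [folklore] -/
def realMatrixTwo (z : Fin 4 → ℝ) : Matrix (Fin 2) (Fin 2) ℝ :=
  !![z 0, z 1; z 2, z 3]

/-- Lovas–Andai's similarity transform `V_ε⁻¹ X V_ε = [[z0, ε z1], [z2 / ε, z3]]`,
`V_ε = diag(1, ε)`, written out on entries (meaningful for `ε ≠ 0`).
[cite: LovasAndai2017, Definition 1 (V_ε)] -/
def lovasAndaiConj (ε : ℝ) (z : Fin 4 → ℝ) : Matrix (Fin 2) (Fin 2) ℝ :=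
  !![z 0, ε * z 1; z 2 / ε, z 3]

/-- **Lovas–Andai's `χ₁(ε)`** (Definition 1, `d = 1`): the Lebesgue measure of the set of
`X ∈ ℝ^{2×2}` with `‖X‖ < 1` and `‖V_ε⁻¹ X V_ε‖ < 1` (operator norms), the strict unit-ball
conditions spelled `1 − XᵀX ≻ 0` by their Lemma 3. [cite: LovasAndai2017, Definition 1 and Lemma 3] -/
def lovasAndaiChiOne (ε : ℝ) : ℝ≥0∞ :=
  volume {z : Fin 4 → ℝ |
    (1 - (realMatrixTwo z)ᵀ * realMatrixTwo z).PosDef ∧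
      (1 - (lovasAndaiConj ε z)ᵀ * lovasAndaiConj ε z).PosDef}

/-- **Lovas–Andai 2017, §5: `χ₁(1) = 2π²/3`** — the (entry-)Lebesgue volume of the operator-norm
unit ball of `ℝ^{2×2}` (at `ε = 1` the second condition of `χ₁` repeats the first).
[cite: LovasAndai2017, §5 (real case, χ₁(1) = 2π²/3)] -/
def LovasAndai2017_chiOne_one : Prop :=
  lovasAndaiChiOne 1 = ENNReal.ofReal (2 / 3 * Real.pi ^ 2)

/-- **Lovas–Andai 2017, Lemma 6 (the normalised defect function `χ̃₁ = χ₁/χ₁(1)`).** For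
`0 < ε ≤ 1`:
`χ₁(ε) / χ₁(1) = (4/π²) ∫₀^ε (s + 1/s − ½ (s − 1/s)² log((1+s)/(1−s))) (1/s) ds`.
[cite: LovasAndai2017, Lemma 6] -/
def LovasAndai2017_lemma6 : Prop :=
  ∀ ε : ℝ, 0 < ε → ε ≤ 1 →
    (lovasAndaiChiOne ε).toReal / (lovasAndaiChiOne 1).toReal =
      4 / Real.pi ^ 2 *
        ∫ s in Set.Ioc (0 : ℝ) ε,
          (s + s⁻¹ - (s - s⁻¹) ^ 2 / 2 * Real.log ((1 + s) / (1 - s))) / s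

/-! ### Sanity lemmas -/

/-- At `ε = 1` the similarity transform is the identity on entries. [folklore] -/
theorem lovasAndaiConj_one (z : Fin 4 → ℝ) : lovasAndaiConj 1 z = realMatrixTwo z := by
  ext i j; fin_cases i <;> fin_cases j <;> simp [lovasAndaiConj, realMatrixTwo]

/-- Hence `χ₁(1)` is the measure of the strict operator-norm unit ball alone. [folklore] -/
theorem lovasAndaiChiOne_one_eq :
    lovasAndaiChiOne 1 =
      volume {z : Fin 4 → ℝ | (1 - (realMatrixTwo z)ᵀ * realMatrixTwo z).PosDef} := by
  simp only [lovasAndaiChiOne, lovasAndaiConj_one, and_self]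

/-- The similarity transform preserves the determinant (for `ε ≠ 0`). [folklore] -/
theorem det_lovasAndaiConj {ε : ℝ} (hε : ε ≠ 0) (z : Fin 4 → ℝ) :
    (lovasAndaiConj ε z).det = (realMatrixTwo z).det := by
  simp [lovasAndaiConj, realMatrixTwo, Matrix.det_fin_two]
  field_simp

end Literature.Probability.RandomMatrix

end
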